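import Literature.Barriers.ResolutionOfSingularities.LocalMonomializationFails
import Literature.AlgebraicGeometry.Resolution.AffineDomainEquidim
import Literature.AlgebraicGeometry.Resolution.AffineDomainDimension
import Mathlib.RingTheory.Localization.AtPrime.Basic
import HarnessLib

/-!
# Algebraic local rings dominated by a valuation with scalar residues are full-dimensional

`Literature/Barriers/ResolutionOfSingularities/LocalMonomializationFailsAlgebraic.lean` — the
dimension count behind "the top row of (12) is the complete list of all TWO DIMENSIONAL regular
algebraic local rings of `K*` dominating `B` and dominated by `V*`" in Cutkosky §3 (p. 7): an
algebraic local ring `A = R_𝔭` (`R` finitely generated over `F`, `IsAlgebraicLocalRingOf`,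
`LocalMonomializationFails.lean`) of an `F`-field `E` of transcendence degree `d`, contained in a
valuation ring `O` of `E` every element of which is congruent to a scalar modulo `𝔪_O` (as is
`V* = ∪ B_i`, all `B_i` having residue field `F`), has `𝔭` MAXIMAL (its residue ring is spanned
by scalars), hence `dim A = dim R_𝔭 = dim R = trdeg_F E = d` by the dimension theorem for affine
domains (tree: `AffineDomainEquidim`, Matsumura Thm. 5.6 / Ex. 5.1). PROVED; infrastructure for
the discharge of `Cutkosky2014`. Stated for local rings whose quotient field is the ambient `E`
(`IsAlgebraicLocalRingOf F E ⊤ A`); the rings `A_i` of the subfield `K` are handled by pulling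
back to the field `K` itself (`QuadraticTransformsTransport.lean`). [cite: Cutkosky2014, §3 (p. 7)]
-/

noncomputable section

namespace Literature.Barriers.ResolutionOfSingularities

namespace Cutkosky

open Literature.AlgebraicGeometry.Resolution IsLocalRing

universe u

variable {F : Type u} [Field F] {E : Type u} [Field E] [Algebra F E]

/-! ## An algebraic local ring is the localisation of its finitely generated model -/

section Localization

variable {A R : Subalgebra F E} (hRA : R ≤ A)

/-- The contraction `𝔭 = 𝔪_A ∩ R` of the maximal ideal of a local `A ⊇ R`. [folklore] -/
def contraction [IsLocalRing A] : Ideal R :=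
  (maximalIdeal A).comap (Subalgebra.inclusion hRA)

/-- The contraction is prime. [folklore] -/
instance contraction.isPrime [IsLocalRing A] : (contraction hRA).IsPrime :=
  Ideal.comap_isPrime _ _

/-- Membership in the contraction: `r ∈ 𝔭 ↔ r ∈ 𝔪_A`. [folklore] -/
theorem mem_contraction_iff [IsLocalRing A] (r : R) :
    r ∈ contraction hRA ↔ (Subalgebra.inclusion hRA r) ∈ maximalIdeal A :=
  Iff.rfl

/-- **`A = R_𝔭`**: a local `A ⊇ R` all of whose elements are fractions `r/s` with `r, s ∈ R` and
`s` a unit of `A` is the localisation of `R` at `𝔭 = 𝔪_A ∩ R` (the clause of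
`IsAlgebraicLocalRingOf`). [folklore] -/
theorem isLocalization_of_forall_exists_div [IsLocalRing A]
    (hfrac : ∀ x ∈ A, ∃ r ∈ R, ∃ s ∈ R, s ≠ 0 ∧ s⁻¹ ∈ A ∧ x = r / s) :
    @IsLocalization.AtPrime R _ A _ (inclusionAlgebra hRA) (contraction hRA) _ := by
  letI : Algebra R A := inclusionAlgebra hRA
  refine
    { map_units := ?_
      surj := ?_
      exists_of_eq := ?_ }
  · intro s
    have hs : (s : R) ∉ contraction hRA := s.2
    rw [mem_contraction_iff, IsLocalRing.mem_maximalIdeal, mem_nonunits_iff, not_not] at hs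
    exact hs
  · intro x
    obtain ⟨r, hr, s, hs, hs0, hsinv, hx⟩ := hfrac x x.2
    have hsu : IsUnit (⟨s, hRA hs⟩ : A) := Submonoid.isUnit_iff_and.mpr ⟨hs0, hsinv⟩
    have hsp : (⟨s, hs⟩ : R) ∈ (contraction hRA).primeCompl := by
      change (⟨s, hs⟩ : R) ∉ contraction hRA
      rw [mem_contraction_iff, IsLocalRing.mem_maximalIdeal, mem_nonunits_iff, not_not]
      exact hsu
    refine ⟨(⟨r, hr⟩, ⟨⟨s, hs⟩, hsp⟩), Subtype.ext ?_⟩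
    change (x : E) * s = r
    rw [hx, div_mul_cancel₀ _ hs0]
  · intro a b hab
    refine ⟨1, ?_⟩
    have : ((a : R) : E) = b := congrArg (fun t : A => (t : E)) hab
    simpa using Subtype.ext this

end Localization

/-! ## Full dimension under a valuation ring with scalar residues -/

/-- An element of a subalgebra `A ⊆ O` of value `< 1` is not a unit of `A`. [folklore] -/
theorem mem_maximalIdeal_of_valuation_lt_one {A : Subalgebra F E} [IsLocalRing A]
    {O : ValuationSubring E} (hAO : A.toSubring ≤ O.toSubring) {a : A}
    (ha : O.valuation (a : E) < 1) : a ∈ maximalIdeal A := by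
  rw [IsLocalRing.mem_maximalIdeal, mem_nonunits_iff]
  intro hu
  obtain ⟨h0, hinv⟩ := Submonoid.isUnit_iff_and.mp hu
  have h1 : O.valuation (a : E)⁻¹ ≤ 1 := (O.valuation_le_one_iff _).mpr (hAO hinv)
  rw [map_inv₀, inv_le_one₀ (pos_iff_ne_zero.mpr ((map_ne_zero _).mpr h0))] at h1
  exact not_lt.mpr h1 ha

/-- **Scalar residues force the contraction to be maximal.** If every element of the valuation
ring `O ⊇ A ⊇ R` is congruent to a scalar modulo `𝔪_O`, then `R/(𝔪_A ∩ R)` is spanned by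
scalars, so `𝔪_A ∩ R` is a maximal ideal of `R` (the source only uses the conclusion
"two dimensional", p. 7). [folklore] -/
theorem contraction_isMaximal {A R : Subalgebra F E} [IsLocalRing A] (hRA : R ≤ A)
    {O : ValuationSubring E} (hAO : A.toSubring ≤ O.toSubring)
    (hres : ∀ z ∈ O, ∃ c : F, O.valuation (z - algebraMap F E c) < 1) :
    (contraction hRA).IsMaximal := by
  apply Ideal.Quotient.maximal_of_isField
  refine
    { exists_pair_ne := ⟨0, 1, ?_⟩
      mul_comm := mul_comm
      mul_inv_cancel := ?_ }
  · intro h01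
    have h1 : (1 : R) ∈ contraction hRA := by
      rw [← Ideal.Quotient.eq_zero_iff_mem, map_one]; exact h01.symm
    exact (contraction hRA).ne_top_iff_one.mp (Ideal.IsPrime.ne_top inferInstance) h1
  · intro q hq
    obtain ⟨r, rfl⟩ := Ideal.Quotient.mk_surjective q
    obtain ⟨c, hc⟩ := hres (r : E) (hAO (hRA r.2))
    -- `r - c ∈ 𝔭`
    have hrc : r - algebraMap F R c ∈ contraction hRA := by
      rw [mem_contraction_iff]
      exact mem_maximalIdeal_of_valuation_lt_one hAO (by simpa using hc)
    have hc0 : c ≠ 0 := by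
      rintro rfl
      apply hq
      rw [Ideal.Quotient.eq_zero_iff_mem]
      simpa using hrc
    refine ⟨Ideal.Quotient.mk _ (algebraMap F R c⁻¹), ?_⟩
    rw [← map_mul, ← (Ideal.Quotient.mk (contraction hRA)).map_one, Ideal.Quotient.eq]
    have : r * algebraMap F R c⁻¹ - 1 = (r - algebraMap F R c) * algebraMap F R c⁻¹ := by
      rw [sub_mul, ← map_mul, mul_inv_cancel₀ hc0, map_one]
    rw [this]
    exact Ideal.mul_mem_right _ _ hrc

/-- **An algebraic local ring dominated by a valuation ring with scalar residues is
full-dimensional**: for `A = R_𝔭 ⊆ O ⊆ E` an algebraic local ring of the `F`-field `E`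
(`IsAlgebraicLocalRingOf F E ⊤ A`) with `trdeg_F E = d`, if every element of `O` is a scalar
modulo `𝔪_O` then `dim A = d`. (For Cutkosky's `V* = ∪ B_i`: every regular algebraic local ring
of `K*` dominated by `V*` is two-dimensional.) [cite: Cutkosky2014, §3 (p. 7)] -/
theorem ringKrullDim_eq_of_isAlgebraicLocalRingOf {A : Subalgebra F E}
    (hA : IsAlgebraicLocalRingOf F E ⊤ A) {O : ValuationSubring E}
    (hAO : A.toSubring ≤ O.toSubring)
    (hres : ∀ z ∈ O, ∃ c : F, O.valuation (z - algebraMap F E c) < 1)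
    {d : ℕ} (hd : Algebra.trdeg F E = d) : ringKrullDim A = d := by
  obtain ⟨hloc, -, hfracE, R, hRfg, hRA, hfrac⟩ := hA
  haveI := hloc
  letI : Algebra R A := inclusionAlgebra hRA
  haveI := isLocalization_of_forall_exists_div hRA hfrac
  haveI : (contraction hRA).IsMaximal := contraction_isMaximal hRA hAO hres
  haveI : Algebra.FiniteType F R := R.fg_iff_finiteType.mp hRfg
  -- `A ≅ R_𝔭`
  have e : Localization.AtPrime (contraction hRA) ≃ₐ[R] A :=
    IsLocalization.algEquiv (contraction hRA).primeCompl _ _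
  rw [← ringKrullDim_eq_of_ringEquiv e.toRingEquiv,
    ringKrullDim_localization_atPrime_eq_of_isMaximal F (contraction hRA)]
  -- `dim R = trdeg_F R = trdeg_F E = d`
  obtain ⟨n, hn, htr⟩ := exists_ringKrullDim_eq_and_trdeg_eq F R
  haveI : IsFractionRing R E := by
    refine IsFractionRing.of_field R E fun z => ?_
    obtain ⟨a, ha, b, hb, -, rfl⟩ := hfracE z IntermediateField.mem_top
    obtain ⟨r₁, hr₁, s₁, hs₁, hs₁0, -, rfl⟩ := hfrac a ha
    obtain ⟨r₂, hr₂, s₂, hs₂, hs₂0, -, rfl⟩ := hfrac b hb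
    refine ⟨⟨r₁ * s₂, R.mul_mem hr₁ hs₂⟩, ⟨s₁ * r₂, R.mul_mem hs₁ hr₂⟩, ?_⟩
    change r₁ / s₁ / (r₂ / s₂) = r₁ * s₂ / (s₁ * r₂)
    rw [div_div_div_eq]
  have htrE : Algebra.trdeg F E = Algebra.trdeg F R := trdeg_eq_trdeg_of_isFractionRing R
  rw [hn]
  have : (n : Cardinal) = d := by rw [← htr, ← htrE, hd]
  have hnd : n = d := by exact_mod_cast this
  rw [hnd]

end Cutkosky

end Literature.Barriers.ResolutionOfSingularities

end
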